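import Summits.QuantumFields.YangMills.Theorems.HypercubicLimit.Negative.ReflectedDensity
import Summits.QuantumFields.YangMills.Theorems.HypercubicLimit.Negative.AllTimesGapFalse
import Summits.QuantumFields.YangMills.Theorems.LatticeGapOnTrajectory.Negative.ZeroCoupling
import Literature.Probability.LatticeModels.ONModelSpecification
import Literature.MathematicalPhysics.QuantumLattice.GaugeGroupsProofs
import Literature.MathematicalPhysics.QuantumFieldTheory.LatticeGaugeProofs

/-!
# `HypercubicLimit` — negative-side support for the picked line `conditional-mean-telescoping`:
# guards of the telescoping bound (T) and of the influence window (WI)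

Support file for crux `stmt-QuantumFields-8646` (`HypercubicLimit`), refuter side (drefute gen 3), about the
registered stub set of `Cruxes/HypercubicLimit/Lines/conditional-mean-telescoping.lean` (reshape 2); the line's
objects `cubeEdges`, `cubeEdgesT`, `exterior`, `influence` are mirrored VERBATIM, `torusPlaquette` is the tree
copy of `ReflectedDensity.lean`.

* `influence_diag`: for a diagonal orientation `i = j` the influence profile vanishes identically (the
  plaquette holonomy is the junk value `1`, the centred observable is `0`).  Hence the orientation guards
  `i ≠ j →` of the window stubs (WI₂) `CornerFreeInfluence` and (WIₙ) `InfluenceReverseHolder` are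
  decoration: `cornerFree_body_diag`, `reverseHolder_body_diag` (the `i = j` instances of their bodies hold
  for every `C ≥ 0`, resp. every `C, γ`).
* `condExp_centredPlaquette_beta_zero`, `influence_beta_zero`: at `β = 0` the conditional mean of a centred
  plaquette given the links off a cube containing it is `0` (independent Haar links), so every influence
  norm vanishes at `β = 0`.
* `not_telescopingBoundWithoutLeS`: the torus-aliasing guard `|x k μ - x l μ| ≤ S` of the telescoping bound
  (T) (`ConditionalMeanTelescoping.TelescopingBound`, first conjunct of the registered `stub_telescoping`, and
  the shape of `GaussianDomination`) is LOAD-BEARING: with it deleted the statement is false (witness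
  `G = SU(2)`, `β = 0`, `S = 4`, `R = 1`, `n = 2`, base points `0` and `9 e₀`, which alias on the torus of
  side `9`: the bound would read `Var(p₀₁) ≤ 0`).  Any proof of (T) must use the guard; no reshape may drop
  it (gen-2 drefute showed on paper that the companion guard `4R+4 < 2S+1` is, by contrast, redundant for
  `n ≥ 2`). [folklore]
-/

noncomputable section

open scoped ENNReal
open MeasureTheory Filter Topology ProbabilityTheory
open Literature.Probability.LatticeModels (Torus.proj)
open Literature.MathematicalPhysics.AQFT Literature.MathematicalPhysics.QuantumLattice
open Literature.MathematicalPhysics.QuantumFieldTheory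

namespace Summit.QuantumFields.YangMills.Theorems.HypercubicLimit.Negative

/-! ## §1 Objects of the line (verbatim) -/

section Objects
variable {G : Type} [Group G] [TopologicalSpace G] [IsTopologicalGroup G] [CompactSpace G]
  [MeasurableSpace G] [BorelSpace G]

/-- VERBATIM `ConditionalMeanTelescoping.cubeEdges`: edges of `ℤ⁴` interior to the `ℓ^∞`-cube of radius
`R` about `x` (both endpoints inside). [folklore] -/
def cubeEdges (R : ℕ) (x : Fin 4 → ℤ) : Set (Literature.MathematicalPhysics.QuantumLattice.ZdEdge 4) :=
  {e | (∀ μ, |e.1 μ - x μ| ≤ R) ∧ ∀ μ, |e.1 μ + (if μ = e.2 then 1 else 0) - x μ| ≤ R}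

/-- VERBATIM `ConditionalMeanTelescoping.cubeEdgesT`: their images on the torus of side `L`. [folklore] -/
def cubeEdgesT (L R : ℕ) (x : Fin 4 → ℤ) : Set (Edge 4 L) :=
  torusEdge L '' cubeEdges R x

/-- VERBATIM `ConditionalMeanTelescoping.exterior`: the exterior σ-algebra of the cube `Q_R(x)`. [folklore] -/
@[reducible] def exterior (L R : ℕ) (x : Fin 4 → ℤ) : MeasurableSpace (GaugeConfig 4 L G) :=
  cylinderEvents (X := fun _ : Edge 4 L => G) (cubeEdgesT L R x)ᶜ

/-- VERBATIM `ConditionalMeanTelescoping.influence`: the influence profile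
`‖E_{β,S}[δp_{ij}(x) | exterior of Q_R(x)]‖_{Lᵖ}` on the symmetric torus of side `2S+1`. [folklore] -/
def influence (r : LatticeRep G) (β : ℝ) (S R : ℕ) (x : Fin 4 → ℤ) (i j : Fin 4) (p : ℝ≥0∞) : ℝ :=
  let μ := wilsonMeasure (d := 4) (L := 2 * S + 1) r.ρ β
  let X : GaugeConfig 4 (2 * S + 1) G → ℝ :=
    fun U => torusPlaquette r (2 * S + 1) i j x U - ∫ V, torusPlaquette r (2 * S + 1) i j x V ∂μ
  (eLpNorm (μ[X | exterior (2 * S + 1) R x]) p μ).toReal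

end Objects

/-! ## §2 Diagonal orientations: the influence vanishes, the `i ≠ j` guards are decoration -/

section Diagonal

variable {G : Type} [Group G] [TopologicalSpace G] [IsTopologicalGroup G] [CompactSpace G]
  [MeasurableSpace G] [BorelSpace G]

omit [IsTopologicalGroup G] [CompactSpace G] [MeasurableSpace G] [BorelSpace G] in
/-- A "plaquette" of diagonal orientation has holonomy `1`, so its observable is the constant `N`. [folklore] -/
theorem torusPlaquette_diag (r : LatticeRep G) (L : ℕ) (i : Fin 4) (x : Fin 4 → ℤ)
    (U : GaugeConfig 4 L G) : torusPlaquette r L i i x U = r.N := by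
  simp [torusPlaquette, plaquetteObs, plaquetteHolonomyZd, Matrix.trace_one]

/-- **The influence of a diagonal orientation vanishes identically** (every `β, S, R, x, p`). [folklore] -/
theorem influence_diag (r : LatticeRep G) (β : ℝ) (S R : ℕ) (x : Fin 4 → ℤ) (i : Fin 4) (p : ℝ≥0∞) :
    influence r β S R x i i p = 0 := by
  haveI := isProbabilityMeasure_wilsonMeasure (d := 4) (L := 2 * S + 1) r.ρ r.continuous β
  have h0 : (fun U : GaugeConfig 4 (2 * S + 1) G => torusPlaquette r (2 * S + 1) i i x U -
      ∫ V, torusPlaquette r (2 * S + 1) i i x V ∂(wilsonMeasure (d := 4) (L := 2 * S + 1) r.ρ β)) = 0 := by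
    funext U
    simp [torusPlaquette_diag]
  simp only [influence, h0, condExp_zero, eLpNorm_zero, ENNReal.toReal_zero]

end Diagonal

/-! ## §3 `β = 0`: independent links, vanishing conditional means -/

section BetaZero

variable {G : Type} [Group G] [TopologicalSpace G] [IsTopologicalGroup G] [CompactSpace G]
  [MeasurableSpace G] [BorelSpace G]

/-- Under product Haar the coordinate σ-algebras of disjoint link sets are independent. [folklore] -/
theorem indep_cylinderEvents_pi {L : ℕ} [NeZero L] (Λ T : Set (Edge 4 L)) (h : Disjoint Λ T) :
    Indep (cylinderEvents (X := fun _ : Edge 4 L => G) Λ) (cylinderEvents (X := fun _ : Edge 4 L => G) T)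
      (Measure.pi fun _ : Edge 4 L => haarProbability G) := by
  have hind : iIndepFun (fun (e : Edge 4 L) (U : GaugeConfig 4 L G) => U e)
      (Measure.pi fun _ : Edge 4 L => haarProbability G) := by
    simpa using iIndepFun_pi (μ := fun _ : Edge 4 L => haarProbability G)
      (X := fun (_ : Edge 4 L) (g : G) => g) (fun _ => aemeasurable_id)
  have hle : ∀ e : Edge 4 L,
      MeasurableSpace.comap (fun U : GaugeConfig 4 L G => U e) (inferInstance : MeasurableSpace G) ≤
        (inferInstance : MeasurableSpace (GaugeConfig 4 L G)) :=
    fun e => (measurable_pi_apply e).comap_le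
  exact indep_iSup_of_disjoint hle hind.iIndep h

/-- The four torus links of the plaquette `p_{ij}(x)`, `i ≠ j`, are images of `ℤ⁴` edges interior to every
cube `Q_R(x)`, `R ≥ 1`. [folklore] -/
theorem plaquette_edges_subset_cubeEdgesT (L : ℕ) {R : ℕ} (hR : 1 ≤ R) (x : Fin 4 → ℤ) {i j : Fin 4}
    (hij : i ≠ j) :
    ({torusEdge L (x, i), torusEdge L (x + Pi.single i 1, j), torusEdge L (x + Pi.single j 1, i),
        torusEdge L (x, j)} : Set (Edge 4 L)) ⊆ cubeEdgesT L R x := by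
  have key : ∀ (a b : Fin 4), a ≠ b →
      ((x, a) ∈ cubeEdges R x) ∧ ((x + Pi.single a 1, b) ∈ cubeEdges R x) := by
    intro a b hab
    refine ⟨⟨fun μ => by simp, fun μ => ?_⟩, ⟨fun μ => ?_, fun μ => ?_⟩⟩
    · by_cases h : μ = a <;> simp [h, hR]
    · by_cases h : μ = a
      · subst h; simp [hR]
      · simp [Pi.single_eq_of_ne h]
    · by_cases h : μ = a
      · subst h
        have hb : μ ≠ b := hab
        simp [hb, hR]
      · by_cases h' : μ = b
        · subst h'; simp [Pi.single_eq_of_ne h, hR]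
        · simp [Pi.single_eq_of_ne h, h']
  intro e he
  simp only [Set.mem_insert_iff, Set.mem_singleton_iff] at he
  rcases he with rfl | rfl | rfl | rfl
  · exact ⟨_, (key i j hij).1, rfl⟩
  · exact ⟨_, (key i j hij).2, rfl⟩
  · exact ⟨_, (key j i hij.symm).2, rfl⟩
  · exact ⟨_, (key j i hij.symm).1, rfl⟩

/-- **At `β = 0` the conditional mean of a centred plaquette given the links outside a cube containing it
vanishes a.e.** (the plaquette reads four links interior to the cube, which under product Haar are
independent of the exterior links). [folklore] -/
theorem condExp_centredPlaquette_beta_zero (r : LatticeRep G) (S : ℕ) {R : ℕ} (hR : 1 ≤ R)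
    (x : Fin 4 → ℤ) {i j : Fin 4} (hij : i ≠ j) :
    (wilsonMeasure (d := 4) (L := 2 * S + 1) r.ρ 0)[fun U =>
        torusPlaquette r (2 * S + 1) i j x U -
          ∫ V, torusPlaquette r (2 * S + 1) i j x V ∂(wilsonMeasure (d := 4) (L := 2 * S + 1) r.ρ 0) |
        exterior (2 * S + 1) R x] =ᵐ[wilsonMeasure (d := 4) (L := 2 * S + 1) r.ρ 0] 0 := by
  haveI : SecondCountableTopology G :=
    (r.continuous.isClosedEmbedding r.injective).isEmbedding.secondCountableTopology
  set L : ℕ := 2 * S + 1 with hL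
  set μ := wilsonMeasure (d := 4) (L := L) r.ρ 0 with hμ
  haveI : IsProbabilityMeasure μ := isProbabilityMeasure_wilsonMeasure (d := 4) (L := L) r.ρ r.continuous 0
  have hμpi : μ = Measure.pi fun _ : Edge 4 L => haarProbability G :=
    Theorems.LatticeGapOnTrajectory.Negative.wilsonMeasure_zero_coupling r.ρ L
  set X : GaugeConfig 4 L G → ℝ := fun U =>
    torusPlaquette r L i j x U - ∫ V, torusPlaquette r L i j x V ∂μ with hX
  -- measurability of `X` for the cube σ-algebra
  have hle₁ : cylinderEvents (X := fun _ : Edge 4 L => G) (cubeEdgesT L R x) ≤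
      (inferInstance : MeasurableSpace (GaugeConfig 4 L G)) := cylinderEvents_le_pi
  have hle₂ : cylinderEvents (X := fun _ : Edge 4 L => G) (cubeEdgesT L R x)ᶜ ≤
      (inferInstance : MeasurableSpace (GaugeConfig 4 L G)) := cylinderEvents_le_pi
  have hXm : StronglyMeasurable[cylinderEvents (X := fun _ : Edge 4 L => G) (cubeEdgesT L R x)] X := by
    refine Measurable.stronglyMeasurable ?_
    have h1 : Measurable[cylinderEvents (X := fun _ : Edge 4 L => G)
        {torusEdge L (x, i), torusEdge L (x + Pi.single i 1, j), torusEdge L (x + Pi.single j 1, i),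
          torusEdge L (x, j)}] X := by
      refine Measurable.measurable_cylinderEvents_of_dependsOn ?_ ?_
      · exact (measurable_torusPlaquette r L i j x).sub measurable_const
      · intro U V h
        simp only [hX]
        rw [dependsOn_torusPlaquette r L i j x h]
    exact h1.mono (cylinderEvents_mono (plaquette_edges_subset_cubeEdgesT L hR x hij)) le_rfl
  -- independence of cube and exterior under product Haar
  have hind : Indep (cylinderEvents (X := fun _ : Edge 4 L => G) (cubeEdgesT L R x))
      (cylinderEvents (X := fun _ : Edge 4 L => G) (cubeEdgesT L R x)ᶜ) μ := by
    rw [hμpi]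
    exact indep_cylinderEvents_pi _ _ disjoint_compl_right
  haveI : SigmaFinite (μ.trim hle₂) := by infer_instance
  have hmean : ∫ U, X U ∂μ = 0 := by
    have hint : Integrable (torusPlaquette r L i j x) μ := by
      refine Integrable.of_bound (measurable_torusPlaquette r L i j x).aestronglyMeasurable r.N
        (Eventually.of_forall fun U => ?_)
      rw [Real.norm_eq_abs]
      exact abs_plaquetteObs_le_holds (ρ := r.ρ) r.mem_unitary x i j _
    simp only [hX]
    rw [integral_sub hint (integrable_const _), integral_const, probReal_univ, one_smul, sub_self]
  have key := condExp_indep_eq hle₁ hle₂ hXm hind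
  rw [hmean] at key
  exact key

/-- **Every influence norm vanishes at `β = 0`** (`R ≥ 1`). [folklore] -/
theorem influence_beta_zero (r : LatticeRep G) (S : ℕ) {R : ℕ} (hR : 1 ≤ R) (x : Fin 4 → ℤ)
    (i j : Fin 4) (p : ℝ≥0∞) : influence r 0 S R x i j p = 0 := by
  by_cases hij : i = j
  · subst hij; exact influence_diag r 0 S R x i p
  · simp only [influence]
    rw [eLpNorm_congr_ae (condExp_centredPlaquette_beta_zero r S hR x hij), eLpNorm_zero,
      ENNReal.toReal_zero]

end BetaZero

/-! ## §4 The telescoping bound (T): the torus-aliasing guard `≤ S` is load-bearing -/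

section Telescoping

variable {G : Type} [Group G] [TopologicalSpace G] [IsTopologicalGroup G] [CompactSpace G]
  [MeasurableSpace G] [BorelSpace G]

omit [IsTopologicalGroup G] [CompactSpace G] [MeasurableSpace G] [BorelSpace G] in
/-- **Torus aliasing**: base points differing by a multiple of the side carry the SAME torus plaquette. [folklore] -/
theorem torusPlaquette_add_natCast_smul (r : LatticeRep G) (L : ℕ) (i j : Fin 4) (x v : Fin 4 → ℤ)
    (U : GaugeConfig 4 L G) :
    torusPlaquette r L i j (x + (L : ℤ) • v) U = torusPlaquette r L i j x U := by
  unfold torusPlaquette plaquetteObs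
  have hp : Torus.proj L (x + (L : ℤ) • v) = Torus.proj L x := by funext i; simp [Torus.proj]
  rw [Theorems.CurvatureBoostCovariance.Negative.plaquetteHolonomyZd_torusLift',
    Theorems.CurvatureBoostCovariance.Negative.plaquetteHolonomyZd_torusLift', hp]

omit [IsTopologicalGroup G] [CompactSpace G] [MeasurableSpace G] [BorelSpace G] in
/-- The torus plaquette of the trivial configuration is `N`. [folklore] -/
theorem torusPlaquette_one (r : LatticeRep G) (L : ℕ) (i j : Fin 4) (x : Fin 4 → ℤ) :
    torusPlaquette r L i j x (fun _ => 1) = r.N := by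
  simp [torusPlaquette, plaquetteObs, plaquetteHolonomyZd, torusLift, Matrix.trace_one]

omit [IsTopologicalGroup G] [CompactSpace G] [MeasurableSpace G] [BorelSpace G] in
/-- The torus plaquette `p₀₁(0)` of the configuration carrying `g` on the single link `(0, e₀)` and `1`
elsewhere is `Re tr ρ(g)` (side `≥ 2`). [folklore] -/
theorem torusPlaquette_update (r : LatticeRep G) (L : ℕ) [NeZero L] (hL : (1 : ZMod L) ≠ 0) (g : G) :
    torusPlaquette r L 0 1 0
        (Function.update (fun _ : Edge 4 L => (1 : G))
          ((0 : Literature.MathematicalPhysics.QuantumFieldTheory.Site 4 L), (0 : Fin 4)) g) =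
      (r.ρ g).trace.re := by
  unfold torusPlaquette plaquetteObs
  rw [Theorems.CurvatureBoostCovariance.Negative.plaquetteHolonomyZd_torusLift']
  have h0 : Torus.proj L (0 : Fin 4 → ℤ) = 0 := by funext i; simp [Torus.proj]
  rw [h0]
  simp only [plaquetteHolonomy]
  have e2 : ((0 : Literature.MathematicalPhysics.QuantumFieldTheory.Site 4 L).shift 1, (0 : Fin 4)) ≠
      ((0 : Literature.MathematicalPhysics.QuantumFieldTheory.Site 4 L), (0 : Fin 4)) := by
    intro h
    have h' := congrArg (fun e : Edge 4 L => e.1 1) h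
    simp [Literature.MathematicalPhysics.QuantumFieldTheory.Site.shift] at h'
    exact hL h'
  rw [Function.update_self, Function.update_of_ne (by simp), Function.update_of_ne e2,
    Function.update_of_ne (by simp)]
  simp

omit [IsTopologicalGroup G] [CompactSpace G] [MeasurableSpace G] [BorelSpace G] in
/-- For a faithful unitary `ρ` and `g ≠ 1`, `Re tr ρ(g) ≠ N`. [folklore] -/
theorem re_trace_ne_of_ne_one (r : LatticeRep G) {g : G} (hg : g ≠ 1) : (r.ρ g).trace.re ≠ r.N := by
  intro htr
  have h1 : r.ρ g = 1 := Literature.Barriers.QuantumFields.eq_one_of_re_trace_eq (r.mem_unitary _) htr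
  exact hg (r.injective (by rw [h1, map_one]))

/-- The centred square integrates to the variance. [folklore] -/
theorem integral_centred_mul_self {L : ℕ} [NeZero L] (r : LatticeRep G) (β : ℝ)
    {P : GaugeConfig 4 L G → ℝ} (hP : Continuous P) :
    ∫ U, (P U - ∫ V, P V ∂(wilsonMeasure (d := 4) (L := L) r.ρ β)) *
        (P U - ∫ V, P V ∂(wilsonMeasure (d := 4) (L := L) r.ρ β)) ∂(wilsonMeasure (d := 4) (L := L) r.ρ β) =
      ∫ U, P U * P U ∂(wilsonMeasure (d := 4) (L := L) r.ρ β) -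
        (∫ V, P V ∂(wilsonMeasure (d := 4) (L := L) r.ρ β)) * ∫ V, P V ∂(wilsonMeasure (d := 4) (L := L) r.ρ β) := by
  haveI : SecondCountableTopology G :=
    (r.continuous.isClosedEmbedding r.injective).isEmbedding.secondCountableTopology
  haveI := isProbabilityMeasure_wilsonMeasure (d := 4) (L := L) r.ρ r.continuous β
  set μ := wilsonMeasure (d := 4) (L := L) r.ρ β with hμ
  set c : ℝ := ∫ V, P V ∂μ with hc
  have hint : Integrable P μ := hP.integrable_of_hasCompactSupport (hasCompactSupport_of_gaugeConfig P)
  have hint2 : Integrable (fun W => P W * P W) μ :=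
    (hP.mul hP).integrable_of_hasCompactSupport (hasCompactSupport_of_gaugeConfig _)
  have h1 : (fun U => (P U - c) * (P U - c)) = fun U => P U * P U - (2 * c) * P U + c ^ 2 := by
    funext U; ring
  have e2 : ∫ U, (P U * P U - (2 * c) * P U + c ^ 2) ∂μ =
      (∫ U, P U * P U ∂μ - ∫ U, (2 * c) * P U ∂μ) + ∫ _U, c ^ 2 ∂μ := by
    rw [integral_add (f := fun U => P U * P U - (2 * c) * P U) (g := fun _ => c ^ 2)
      (hint2.sub (hint.const_mul _)) (integrable_const _),
      integral_sub (f := fun U => P U * P U) (g := fun U => (2 * c) * P U) hint2 (hint.const_mul _)]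
  rw [h1, e2, integral_const_mul, integral_const, smul_eq_mul, probReal_univ, ← hc]
  ring

/-- **The torus-aliasing guard `|x k μ - x l μ| ≤ S` of the telescoping bound (T) is load-bearing.**
The negated statement below is `ConditionalMeanTelescoping.TelescopingBound` (= the first conjunct of the
registered `stub_telescoping`, objects unfolded; also the shape of `GaussianDomination`) with ONLY the clause
`|x k μ - x l μ| ≤ S` deleted from the separation hypothesis — and it is FALSE.  Witness: `G = SU(2)` (any
faithful `r`), `β = 0`, `S = 4` (side `9`), `R = 1`, `n = 2`, orientations `(0,1)`, base points `0` and `9e₀`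
— separated on `ℤ⁴` (`9 > 2R+1 = 3`) but EQUAL on the torus (`torusPlaquette_add_natCast_smul`); the bound
then reads `Var(p₀₁) ≤ ‖E[δp | ext Q₁(0)]‖₂ · (…) = 0` (`influence_beta_zero`), while the variance of the
non-constant continuous `p₀₁` under the fully supported Wilson measure is positive (`variance_pos`).  So any
proof of (T) must use the guard and no reshape may drop it. [folklore] -/
theorem not_telescopingBoundWithoutLeS :
    ¬ ∀ (G : Type) [Group G] [TopologicalSpace G] [IsTopologicalGroup G] [CompactSpace G]
        [MeasurableSpace G] [BorelSpace G] (r : LatticeRep G) (β : ℝ) (S R n : ℕ)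
        (o : Fin n → Fin 4 × Fin 4) (x : Fin n → (Fin 4 → ℤ)),
        (∀ k, (o k).1 ≠ (o k).2) →
        4 * R + 4 < 2 * S + 1 →
        (∀ k l, k ≠ l → ∃ μ : Fin 4, (2 * R + 1 : ℤ) < |x k μ - x l μ|) →
          let μ := wilsonMeasure (d := 4) (L := 2 * S + 1) r.ρ β
          |∫ U, ∏ k, (torusPlaquette r (2 * S + 1) (o k).1 (o k).2 (x k) U -
              ∫ V, torusPlaquette r (2 * S + 1) (o k).1 (o k).2 (x k) V ∂μ) ∂μ|
            ≤ ∏ k, influence r β S R (x k) (o k).1 (o k).2 n := by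
  intro h
  have hG : IsCompactSimpleLieGroup (Matrix.specialUnitaryGroup (Fin 2) ℂ) :=
    isCompactSimpleLieGroup_specialUnitaryGroup isSimpleCompactGroup_specialUnitaryGroup_holds le_rfl
  obtain ⟨r⟩ := hG.2
  obtain ⟨a, b, hab⟩ := hG.1.2.1
  have ha : a ≠ 1 := by
    rintro rfl
    exact hab (by rw [one_mul, mul_one])
  -- the aliased instance: `S = 4`, `R = 1`, `n = 2`, orientations `(0,1)`, base points `0`, `9e₀`
  have hinst := h (Matrix.specialUnitaryGroup (Fin 2) ℂ) r 0 4 1 2 (fun _ => ((0 : Fin 4), (1 : Fin 4)))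
    ![0, ((2 * 4 + 1 : ℕ) : ℤ) • Pi.single 0 1] (fun _ => by decide) (by norm_num) (by
      intro k l hkl
      refine ⟨0, ?_⟩
      fin_cases k <;> fin_cases l
      · exact absurd rfl hkl
      · simp
      · simp
      · exact absurd rfl hkl)
  -- names
  set μ := wilsonMeasure (d := 4) (L := 2 * 4 + 1) r.ρ 0 with hμ
  set P : GaugeConfig 4 (2 * 4 + 1) (Matrix.specialUnitaryGroup (Fin 2) ℂ) → ℝ :=
    torusPlaquette r (2 * 4 + 1) 0 1 0 with hP
  have hPc : Continuous P :=
    (continuous_plaquetteObs r.ρ r.continuous 0 0 1).comp (continuous_pi fun e => continuous_apply _)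
  -- the second base point aliases the first
  have halias : ∀ U, torusPlaquette r (2 * 4 + 1) 0 1 (((2 * 4 + 1 : ℕ) : ℤ) • Pi.single 0 1) U = P U := by
    intro U
    have := torusPlaquette_add_natCast_smul r (2 * 4 + 1) 0 1 0 (Pi.single 0 1) U
    rwa [zero_add] at this
  -- right-hand side: the influence at base point `0` vanishes at `β = 0`
  set o : Fin 2 → Fin 4 × Fin 4 := fun _ => ((0 : Fin 4), (1 : Fin 4)) with ho
  set x : Fin 2 → (Fin 4 → ℤ) := ![0, ((2 * 4 + 1 : ℕ) : ℤ) • Pi.single 0 1] with hx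
  have hrhs : ∏ k : Fin 2, influence r 0 4 1 (x k) (o k).1 (o k).2 (2 : ℕ) = 0 := by
    rw [Fin.prod_univ_two]
    simp only [hx, ho, Matrix.cons_val_zero]
    rw [influence_beta_zero r 4 le_rfl 0 0 1, zero_mul]
  -- left-hand side: the variance of `P`
  have hlhs : ∫ U, ∏ k : Fin 2, (torusPlaquette r (2 * 4 + 1) (o k).1 (o k).2 (x k) U -
      ∫ V, torusPlaquette r (2 * 4 + 1) (o k).1 (o k).2 (x k) V ∂μ) ∂μ =
      ∫ U, P U * P U ∂μ - (∫ V, P V ∂μ) * ∫ V, P V ∂μ := by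
    rw [← integral_centred_mul_self r 0 hPc]
    refine integral_congr_ae (Eventually.of_forall fun U => ?_)
    simp only [hx, ho, Fin.prod_univ_two, Matrix.cons_val_zero, Matrix.cons_val_one, halias]
    rfl
  have hle : |∫ U, P U * P U ∂μ - (∫ V, P V ∂μ) * ∫ V, P V ∂μ| ≤ 0 := by
    have := hinst
    simp only at this
    rwa [hlhs, hrhs] at this
  -- but the variance is positive: `P` separates `1` from the one-link configuration carrying `a`
  have h9 : (1 : ZMod (2 * 4 + 1)) ≠ 0 := by decide
  have hne : P (fun _ => 1) ≠
      P (Function.update (fun _ : Edge 4 (2 * 4 + 1) => (1 : Matrix.specialUnitaryGroup (Fin 2) ℂ))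
        ((0 : Literature.MathematicalPhysics.QuantumFieldTheory.Site 4 (2 * 4 + 1)), (0 : Fin 4)) a) := by
    rw [hP, torusPlaquette_one, torusPlaquette_update r (2 * 4 + 1) h9 a]
    exact (re_trace_ne_of_ne_one r ha).symm
  have hpos := variance_pos r 0 (2 * 4 + 1) hPc hne
  have h0 : ∫ U, P U * P U ∂μ - (∫ V, P V ∂μ) * ∫ V, P V ∂μ = 0 :=
    abs_eq_zero.1 (le_antisymm hle (abs_nonneg _))
  rw [hμ, hP] at h0
  linarith

end Telescoping

/-! ## §5 The orientation guards `i ≠ j →` of (WI₂), (WIₙ) are discharged for free -/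

section WindowGuards

variable {G : Type} [Group G] [TopologicalSpace G] [IsTopologicalGroup G] [CompactSpace G]
  [MeasurableSpace G] [BorelSpace G]

/-- **The `i = j` instance of the body of (WI₂) `CornerFreeInfluence` holds for every constant `C ≥ 0`**
(and of any bound with a non-negative right-hand side): the guard `i ≠ j →` of the registered window stub
is decoration once `C` is taken non-negative (replace a guarded `C` by `max C 0`). [folklore] -/
theorem cornerFree_body_diag (r : LatticeRep G) (β : ℝ) (S R : ℕ) (x : Fin 4 → ℤ) (i : Fin 4)
    {C : ℝ} (hC : 0 ≤ C) (A : ℝ) :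
    influence r β S R x i i 2 ≤ C * Real.sqrt A := by
  rw [influence_diag]
  exact mul_nonneg hC (Real.sqrt_nonneg _)

/-- **The `i = j` instance of the body of (WIₙ) `InfluenceReverseHolder` holds for every `C, γ`**
(both sides vanish). [folklore] -/
theorem reverseHolder_body_diag (r : LatticeRep G) (β : ℝ) (S R : ℕ) (x : Fin 4 → ℤ) (i : Fin 4)
    (C : ℝ) (γ n : ℕ) :
    influence r β S R x i i n ≤ C * (n : ℝ) ^ γ * influence r β S R x i i 2 := by
  rw [influence_diag, influence_diag, mul_zero]

end WindowGuards

end Summit.QuantumFields.YangMills.Theorems.HypercubicLimit.Negative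

end
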